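import Summits.ResolutionOfSingularities.ResolutionOfSingularities.Theses.Valuative
import Summits.ResolutionOfSingularities.ResolutionOfSingularities.Theses.TropicalLinks
import Summits.ResolutionOfSingularities.ResolutionOfSingularities.Theses.CyclicCovers
import Literature.AlgebraicGeometry.Resolution.ResolutionOfSingularities
import Literature.AlgebraicGeometry.Resolution.QuasiExcellentSchemes
import Literature.AlgebraicGeometry.Resolution.ComponentGluing
import Mathlib

/-!
# Crux `PatchingRel` (stmt-ResolutionOfSingularities-0642) — round-2 ideator 4: first lemmas of two idea cards

* Card `closed-point-fibre-freedom`: the atom `FibreFreeRegular p n` (fibre-admissible punctual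
  resolution over REGULAR local bases), the lower-dimensional strong input `LocalFibreRes p c`
  (Temkin's local criterion in fibre form, arbitrary local bases), the dimension-graded engine
  `resUpTo_of_fibreFree` (Claims A/B of the card; to be proved by crux-plan) and its dimension-4
  slice fed by `CossartPiltant2019General`.
* Card `torific-patching-schon`: the transfer `TorificPatching` (relative LU ⇒ Tevelev-schön
  re-embeddings, typed verbatim as route TropicalLinks' `SchonAt`) and the PROVED composition
  `patchingRel_of_torificPatching` through the shared items `SchonResolves`,
  `DescentAlgclosedToPerfect`, `DescentPerfectToAll`.
-/

set_option linter.dupNamespace false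
set_option linter.unusedVariables false

noncomputable section

namespace Summit.ResolutionOfSingularities.ResolutionOfSingularities.Cruxes.PatchingRel.Round2Ideator4

open CategoryTheory AlgebraicGeometry
open Literature.AlgebraicGeometry.Resolution
open Summit.ResolutionOfSingularities.ResolutionOfSingularities

/-- The antecedent of the crux: RELATIVE local uniformization in characteristic `p`
(verbatim body of `Theses.Valuative.PatchingRel`). -/
def LUrelP (p : ℕ) : Prop :=
  ∀ (k K : Type) [Field k] [CharP k p] [Field K] [Algebra k K], (⊤ : IntermediateField k K).FG →
    ∀ O : ValuationSubring K, (∀ c : k, algebraMap k K c ∈ O) → ∀ R : Subalgebra k K, R.FG →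
    R.toSubring ≤ O.toSubring → ∃ (A : Subalgebra k K) (h : A.toSubring ≤ O.toSubring),
      R ≤ A ∧ A.FG ∧ IsFractionRing A K ∧
      IsRegularLocalRing (Localization.AtPrime (Ideal.comap (Subring.inclusion h)
        (IsLocalRing.maximalIdeal O)))

/-- Read-back: the crux is literally `∀ p prime, LUrelP p → ResolutionInChar p`. -/
theorem patchingRel_iff_lurelP :
    Theses.Valuative.PatchingRel ↔ ∀ p : ℕ, p.Prime → LUrelP p → ResolutionInChar.{0} p :=
  Iff.rfl

/-! ## Card A — `closed-point-fibre-freedom` -/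

/-- CARD A ATOM — **fibre-free punctual resolution over a REGULAR local base of dimension `≤ n`**:
for a regular local `S` essentially of finite type over a field of characteristic `p`,
`dim S ≤ n`, and an integral `T` proper and birational over `Spec S` which is regular off the
closed fibre, there is a resolution `π : T' → T` which is an isomorphism over the complement of
the closed fibre (NO condition over the regular points OF the closed fibre: this is the only
difference with regular-roof's `C⁺_n`, which asks `π` to be an isomorphism over `Reg T`). -/
def FibreFreeRegular (p n : ℕ) : Prop :=
  ∀ (k : Type) [Field k] [CharP k p] (S : Type) [CommRing S] [IsRegularLocalRing S] [Algebra k S]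
    [Algebra.EssFiniteType k S], ringKrullDim S ≤ n →
    ∀ (T : Scheme.{0}) (f : T ⟶ Spec (.of S)), IsIntegral T → IsProper f → IsBirational f →
    (∀ t : T, f.base t ≠ IsLocalRing.closedPoint S → IsRegularLocalRing (T.presheaf.stalk t)) →
    ∃ (T' : Scheme.{0}) (π : T' ⟶ T), IsResolution π ∧
      ∃ U : T.Opens, (∀ t : T, t ∈ U ↔ f.base t ≠ IsLocalRing.closedPoint S) ∧ IsIso (π ∣_ U)

/-- Lower-dimensional STRONG input — **fibre-admissible punctual resolution over an ARBITRARY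
Noetherian local base of dimension `≤ c`** essentially of finite type over a field of
characteristic `p` (Temkin 2008, Prop. 2.3.4 (iii) in fibre form). For `c ≤ 3` it is
`CossartPiltant2019General` (below); for all `c` it is strong resolution and implies the summit
WITHOUT local uniformization — which is why the card is a statement about the TOP dimension of
each slice only. -/
def LocalFibreRes (p c : ℕ) : Prop :=
  ∀ (k : Type) [Field k] [CharP k p] (S : Type) [CommRing S] [IsLocalRing S] [IsNoetherianRing S]
    [Algebra k S] [Algebra.EssFiniteType k S], ringKrullDim S ≤ c →
    ∀ (T : Scheme.{0}) (f : T ⟶ Spec (.of S)), IsIntegral T → IsProper f → IsBirational f →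
    (∀ t : T, f.base t ≠ IsLocalRing.closedPoint S → IsRegularLocalRing (T.presheaf.stalk t)) →
    ∃ (T' : Scheme.{0}) (π : T' ⟶ T), IsResolution π ∧
      ∃ U : T.Opens, (∀ t : T, t ∈ U ↔ f.base t ≠ IsLocalRing.closedPoint S) ∧ IsIso (π ∣_ U)

/-- Trivially, the arbitrary-base statement contains the regular-base one. -/
theorem fibreFreeRegular_of_localFibreRes {p n : ℕ} (h : LocalFibreRes p n) :
    FibreFreeRegular p n := by
  intro k _ _ S _ _ _ _ hdim T f hT hf hbir hreg
  exact h k S hdim T f hT hf hbir hreg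

/-- DIMENSION-GRADED ENGINE (Claims A/B of the card, to be proved by crux-plan; sizes: Claim A =
Temkin's noetherian induction on the join with bases of dimension `< n`, Claim B = closed bad
points over regular LU roofs, where EVERY fibre-supported modification globalizes):
strong punctual resolution below `n` + relative LU + the fibre-free atom at `n` give weak
resolution of integral varieties of dimension `≤ n`. -/
theorem resUpTo_of_fibreFree (p : ℕ) (hp : p.Prime) (n : ℕ)
    (hlow : ∀ c : ℕ, c < n → LocalFibreRes p c) (hLU : LUrelP p) (hFF : FibreFreeRegular p n) :
    ∀ (k : Type) [Field k] [CharP k p] (X : Scheme.{0}) (f : X ⟶ Spec (.of k)),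
      IsSeparated f → LocallyOfFiniteType f → QuasiCompact f → IsIntegral X →
      topologicalKrullDim X ≤ n → Scheme.HasResolution X := by
  sorry

/-- The lower input in the crux's FIRST OPEN SLICE: `LocalFibreRes p c` for `c ≤ 3` is
Cossart–Piltant 2019 Thm 1.1 (ii) (T is a reduced separated quasi-excellent scheme of dimension
`≤ 3`; `Reg T ⊇ T ∖ T_s`). -/
theorem localFibreRes_le_three (h : CossartPiltant2019General.{0}) (p c : ℕ) (hc : c ≤ 3) :
    LocalFibreRes p c := by
  sorry

/-- DIMENSION-4 SLICE of the crux (the first open case, Disproof §10 `patchingRel_iff_highDim`):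
mod `CossartPiltant2019General`, relative LU + the fibre-free atom in dimension 4 resolve every
integral variety of dimension `≤ 4` over every field of characteristic `p`. -/
theorem res_dim_le_four (h : CossartPiltant2019General.{0}) (p : ℕ) (hp : p.Prime)
    (hLU : LUrelP p) (hFF : FibreFreeRegular p 4) :
    ∀ (k : Type) [Field k] [CharP k p] (X : Scheme.{0}) (f : X ⟶ Spec (.of k)),
      IsSeparated f → LocallyOfFiniteType f → QuasiCompact f → IsIntegral X →
      topologicalKrullDim X ≤ 4 → Scheme.HasResolution X :=
  resUpTo_of_fibreFree p hp 4 (fun c hc => localFibreRes_le_three h p c (by omega)) hLU hFF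

/-! ## Card B — `torific-patching-schon` -/

section CardB
-- elaborate the schön typing exactly as route TropicalLinks does (its file has `open scoped Classical`:
-- the `Finsupp.filter` decidability instance must match for the shared item to apply verbatim)
open scoped BigOperators Classical

/-- Tevelev-schön re-embedding of a `d`-dimensional very affine variety over an algebraically
closed field of characteristic `p`, typed VERBATIM as route TropicalLinks' `SchonAt p d`
(items stmt-ResolutionOfSingularities-17232/17234). -/
def SchonAt (p d : ℕ) : Prop :=
  (fun (p d : ℕ) => ∀ (k : Type) [Field k] [CharP k p] [IsAlgClosed k] (N : ℕ) (I : Ideal (AddMonoidAlgebra k (Fin N → ℤ))), I.IsPrime → ringKrullDim (AddMonoidAlgebra k (Fin N → ℤ) ⧸ I) = (d : WithBot ℕ∞) → ∃ (m : ℕ) (G : Fin m → AddMonoidAlgebra k (Fin N → ℤ)), (∀ j, G j ∉ I) ∧ ∀ (w : Fin (N + m) → ℤ) (P : Ideal (AddMonoidAlgebra k (Fin (N + m) → ℤ) ⧸ Ideal.span ((fun f : AddMonoidAlgebra k (Fin (N + m) → ℤ) => AddMonoidAlgebra.ofCoeff (f.coeff.filter fun v => ∀ u ∈ f.coeff.support,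 ∑ i, w i * v i ≤ ∑ i, w i * u i)) '' (↑(Ideal.span ((fun f : AddMonoidAlgebra k (Fin N → ℤ) => (AddMonoidAlgebra.ofCoeff (f.coeff.mapDomain fun v => Fin.append v (0 : Fin m → ℤ)) : AddMonoidAlgebra k (Fin (N + m) → ℤ))) '' (↑I : Set (AddMonoidAlgebra k (Fin N → ℤ))) ∪ Set.range (fun j : Fin m => AddMonoidAlgebra.single (Fin.append (0 : Fin N → ℤ) (Pi.single j (1 : ℤ))) (1 : k) - AddMonoidAlgebra.ofCoeff ((G j).coeff.mapDomain fun v => Fin.append v (0 : Fin m → ℤ))))) : Set (AddMonoidAlgebra k (Fin (N + m) → ℤ)))))) [P.IsPrime], IsRegularLocalRing (Localization.AtPrime P)) p d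

/-- CARD B TRANSFER — **torific patching**: relative local uniformization in characteristic `p`
implies that every very affine variety over an algebraically closed field of characteristic `p`
has a schön principal-open re-embedding (Teissier's Problem C: combine the finitely many toric
embedded uniformizations that compactness of the Zariski–Riemann space provides into ONE
re-embedding; the gluing is the common refinement of fans). -/
def TorificPatching : Prop :=
  ∀ p : ℕ, p.Prime → LUrelP p → ∀ d : ℕ, (fun (p d : ℕ) => ∀ (k : Type) [Field k] [CharP k p] [IsAlgClosed k] (N : ℕ) (I : Ideal (AddMonoidAlgebra k (Fin N → ℤ))), I.IsPrime → ringKrullDim (AddMonoidAlgebra k (Fin N → ℤ) ⧸ I) = (d : WithBot ℕ∞) → ∃ (m : ℕ) (G : Fin m → AddMonoidAlgebra k (Fin N → ℤ)), (∀ j, G j ∉ I) ∧ ∀ (w : Fin (N + m) → ℤ) (P : Ideal (AddMonoidAlgebra k (Fin (N + m) → ℤ) ⧸ Ideal.span ((fun f : AddMonoidAlgebra k (Fin (N + m) → ℤ) => AddMonoidAlgebra.ofCoeff (f.coeff.filter fun v => ∀ u ∈ f.coeff.support, ∑ i, w i * v i ≤ ∑ i, w i * u i)) '' (↑(Ideal.span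 ((fun f : AddMonoidAlgebra k (Fin N → ℤ) => (AddMonoidAlgebra.ofCoeff (f.coeff.mapDomain fun v => Fin.append v (0 : Fin m → ℤ)) : AddMonoidAlgebra k (Fin (N + m) → ℤ))) '' (↑I : Set (AddMonoidAlgebra k (Fin N → ℤ))) ∪ Set.range (fun j : Fin m => AddMonoidAlgebra.single (Fin.append (0 : Fin N → ℤ) (Pi.single j (1 : ℤ))) (1 : k) - AddMonoidAlgebra.ofCoeff ((G j).coeff.mapDomain fun v => Fin.append v (0 : Fin m → ℤ))))) : Set (AddMonoidAlgebra k (Fin (N + m) → ℤ)))))) [P.IsPrime], IsRegularLocalRing (Localization.AtPrime P)) p d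

/-- Read-back: `TorificPatching` is `∀ p prime, LUrelP p → ∀ d, SchonAt p d`. -/
theorem torificPatching_iff : TorificPatching ↔ ∀ p : ℕ, p.Prime → LUrelP p → ∀ d : ℕ, SchonAt p d :=
  Iff.rfl

set_option maxHeartbeats 800000 in
/-- PROVED composition of card B: torific patching + the three items SHARED with route
TropicalLinks (`SchonResolves`, difficulty L, char-free printed mathematics;
`DescentAlgclosedToPerfect` = stmt-0550; `DescentPerfectToAll` = stmt-0549) give the crux BY NAME.
LU is consumed inside `TorificPatching`, chart against chart, not once. -/
theorem patchingRel_of_torificPatching (hT : TorificPatching)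
    (hRes : Theses.TropicalLinks.SchonResolves)
    (hAlg : Theses.TropicalLinks.DescentAlgclosedToPerfect)
    (hPerf : Theses.TropicalLinks.DescentPerfectToAll) :
    Theses.Valuative.PatchingRel := fun p hp hLU =>
  hPerf p hp (hAlg p hp fun k _ _ _ X f _ _ _ _ =>
    ComponentGluing.hasResolution_of_forall_closeds X f fun Z hZ =>
      hRes p hp (fun d => hT p hp hLU d) k
        (Scheme.IdealSheafData.subscheme (Scheme.IdealSheafData.vanishingIdeal Z))
        (CategoryStruct.comp (Scheme.IdealSheafData.vanishingIdeal Z).subschemeι f)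
        inferInstance inferInstance inferInstance hZ)

/-- The same composition for the CyclicCovers copy of the crux (one term). -/
theorem cyclicCovers_patchingRel_of_torificPatching (hT : TorificPatching)
    (hRes : Theses.TropicalLinks.SchonResolves)
    (hAlg : Theses.TropicalLinks.DescentAlgclosedToPerfect)
    (hPerf : Theses.TropicalLinks.DescentPerfectToAll) :
    Theses.CyclicCovers.PatchingRel :=
  patchingRel_of_torificPatching hT hRes hAlg hPerf

end CardB

end Summit.ResolutionOfSingularities.ResolutionOfSingularities.Cruxes.PatchingRel.Round2Ideator4

end
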